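import Summits.ValiantsHypothesis.ValiantsHypothesis.Theorems.BarrierLeverPartitionMinorsChowInclusionWitness

/-!
# Route BarrierLever — Chow witnesses for partition minors (item 20172, CPM): the INTERSECTION WITNESS
# `∏_a (1 + x_a − y_a)(1 + 2 y_a)`; STAR ROWS WITH ARBITRARY CENTRE × AFFINELY INDEPENDENT COLUMNS

Helper file (`--supports stmt-ValiantsHypothesis-20172`; cell valiant-natproofs, rung V4, 𝒟-side of
door (c); seat val-np-p4 gen 13).  Closes NO item; definition-free.  Conventions of items 19717 /
20172 / 20195 (`x_a = X (Fin.castAdd h a)`, `y_c = X (Fin.natAdd h c)`; a layout `(u, w)` is HIT when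
some product of `h + h` affine forms has `det[coeff_{E (u i) (w j)} ∏ ℓ] ≠ 0`).

The product of the `h + h` affine forms `1 + x_a − y_a`, `1 + 2 y_a` (`a < h`) has partition matrix
`coeff_{x^u y^w} = 2^{#(u ∩ w)}` (`coeff_partitionExpo_intersectionWitness`; per coordinate
`(1 + x − y)(1 + 2y)` has multilinear part `1 + x + y + 2xy`) — the `k = h`, `t = 2` instance of the
seat's tensor blow-down built from the edge-step gadgets `(1 + x_a + (1−t) y_a)(1 + t y_a)`
(`…ChowEdgeStep`; memo HOME/val-np-p4/g13).  Consequences, every height `h`: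
* `chow_hit_of_interPowMinor` — every layout with `det[2^{#(u i ∩ w j)}] ≠ 0` is hit by this product;
* `det_interPow_star`, **`chow_hit_star_of_affineIndependent`** — star rows with ARBITRARY centre `B`
  (`u 0 = B`, `u (a+1) = B ∆ {a}`) against `h + 1` AFFINELY INDEPENDENT columns
  (`det[1 ; [a ∈ w j]] ≠ 0`) are hit: `det[2^{#(u i ∩ w j)}] = ∏_j 2^{#(B ∩ w j)} · ∏_a κ_a · det[1 ; [a ∈ w j]]`,
  `κ_a ∈ {−1/2, 1}`.  (`B = ∅` is val-np-p7 g3's first-order theorem; for `B ≠ ∅` the rows are thick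
  and the class was open in the tree — the «additive limit» kills private-`x` designs exactly on
  affinely DEPENDENT columns.)
* `chow_hit_powerset` — the FULL layout (rows and columns run through all `2^h` subsets, any orders):
  `[2^{#(u i ∩ w j)}] = Z · Z'` over permuted inclusion matrices (`det_inclusionMatrix`), `det ≠ 0`.

WHAT THIS IS NOT: star rows against affinely dependent columns (edgeless degree-class families,
padded sub-cubes) are untouched; nothing on items 20172 / 20195 / 19717 themselves, on crux
stmt-ValiantsHypothesis-14610, or on `VP` versus `VNP`.
-/

set_option linter.dupNamespace false

namespace Summit.ValiantsHypothesis.ValiantsHypothesis.Theorems.BarrierLever.ChowFactor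

open Finset MvPolynomial
open Summit.ValiantsHypothesis.ValiantsHypothesis.Theorems.BarrierLever.ProductStateSums
  (partitionExpo_apply_castAdd partitionExpo_apply_natAdd det_inclusionMatrix)

noncomputable section

variable {h : ℕ}

/-! ## 1. One factor `1 + x_a − y_a`, one factor `1 + 2 y_a` -/

/-- Multiplying by `1 + x_a − y_a`: `coeff_{E u w}(f·(1 + x_a − y_a)) =
coeff_{E u w} f + [a ∈ u]·coeff_{E (u∖a) w} f − [a ∈ w]·coeff_{E u (w∖a)} f`. -/
theorem coeff_partitionExpo_mul_one_add_X_sub_Y {R : Type*} [CommRing R]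
    (f : MvPolynomial (Fin (h + h)) R) (a : Fin h) (u w : Finset (Fin h)) :
    coeff (∑ b ∈ u, Finsupp.single (Fin.castAdd h b) 1 + ∑ c ∈ w, Finsupp.single (Fin.natAdd h c) 1)
        (f * (1 + X (Fin.castAdd h a) - X (Fin.natAdd h a))) =
      coeff (∑ b ∈ u, Finsupp.single (Fin.castAdd h b) 1 + ∑ c ∈ w, Finsupp.single (Fin.natAdd h c) 1) f +
        (if a ∈ u then coeff (∑ b ∈ u.erase a, Finsupp.single (Fin.castAdd h b) 1 +
          ∑ c ∈ w, Finsupp.single (Fin.natAdd h c) 1) f else 0) -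
        (if a ∈ w then coeff (∑ b ∈ u, Finsupp.single (Fin.castAdd h b) 1 +
          ∑ c ∈ w.erase a, Finsupp.single (Fin.natAdd h c) 1) f else 0) := by
  classical
  rw [mul_sub, mul_add, mul_one, coeff_sub, coeff_add, coeff_mul_X', coeff_mul_X']
  have hx : (if Fin.castAdd h a ∈ (∑ b ∈ u, Finsupp.single (Fin.castAdd h b) 1 +
        ∑ c ∈ w, Finsupp.single (Fin.natAdd h c) 1 : Fin (h + h) →₀ ℕ).support then
      coeff ((∑ b ∈ u, Finsupp.single (Fin.castAdd h b) 1 +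
        ∑ c ∈ w, Finsupp.single (Fin.natAdd h c) 1 : Fin (h + h) →₀ ℕ) -
          Finsupp.single (Fin.castAdd h a) 1) f else 0) =
      if a ∈ u then coeff (∑ b ∈ u.erase a, Finsupp.single (Fin.castAdd h b) 1 +
        ∑ c ∈ w, Finsupp.single (Fin.natAdd h c) 1) f else 0 := by
    by_cases ha : a ∈ u
    · rw [if_pos ((castAdd_mem_support_partitionExpo u w a).mpr ha),
        partitionExpo_tsub_single_castAdd, if_pos ha]
    · rw [if_neg (fun hm => ha ((castAdd_mem_support_partitionExpo u w a).mp hm)), if_neg ha]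
  have hy : (if Fin.natAdd h a ∈ (∑ b ∈ u, Finsupp.single (Fin.castAdd h b) 1 +
        ∑ c ∈ w, Finsupp.single (Fin.natAdd h c) 1 : Fin (h + h) →₀ ℕ).support then
      coeff ((∑ b ∈ u, Finsupp.single (Fin.castAdd h b) 1 +
        ∑ c ∈ w, Finsupp.single (Fin.natAdd h c) 1 : Fin (h + h) →₀ ℕ) -
          Finsupp.single (Fin.natAdd h a) 1) f else 0) =
      if a ∈ w then coeff (∑ b ∈ u, Finsupp.single (Fin.castAdd h b) 1 +
        ∑ c ∈ w.erase a, Finsupp.single (Fin.natAdd h c) 1) f else 0 := by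
    by_cases ha : a ∈ w
    · rw [if_pos ((natAdd_mem_support_partitionExpo u w a).mpr ha),
        partitionExpo_tsub_single, if_pos ha]
    · rw [if_neg (fun hm => ha ((natAdd_mem_support_partitionExpo u w a).mp hm)), if_neg ha]
  rw [hx, hy]

/-- Multiplying by `1 + 2 y_a`: `coeff_{E u w}(f·(1 + 2 y_a)) =
coeff_{E u w} f + [a ∈ w]·2·coeff_{E u (w∖a)} f`. -/
theorem coeff_partitionExpo_mul_one_add_two_Y {R : Type*} [CommRing R]
    (f : MvPolynomial (Fin (h + h)) R) (a : Fin h) (u w : Finset (Fin h)) :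
    coeff (∑ b ∈ u, Finsupp.single (Fin.castAdd h b) 1 + ∑ c ∈ w, Finsupp.single (Fin.natAdd h c) 1)
        (f * (1 + 2 * X (Fin.natAdd h a))) =
      coeff (∑ b ∈ u, Finsupp.single (Fin.castAdd h b) 1 + ∑ c ∈ w, Finsupp.single (Fin.natAdd h c) 1) f +
        (if a ∈ w then 2 * coeff (∑ b ∈ u, Finsupp.single (Fin.castAdd h b) 1 +
          ∑ c ∈ w.erase a, Finsupp.single (Fin.natAdd h c) 1) f else 0) := by
  classical
  have e : f * (1 + 2 * X (Fin.natAdd h a)) = f + C 2 * (f * X (Fin.natAdd h a)) := by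
    rw [show (2 : MvPolynomial (Fin (h + h)) R) = C 2 from (map_ofNat C 2).symm]
    ring
  rw [e, coeff_add, coeff_C_mul, coeff_mul_X']
  congr 1
  by_cases ha : a ∈ w
  · rw [if_pos ((natAdd_mem_support_partitionExpo u w a).mpr ha), partitionExpo_tsub_single, if_pos ha]
  · rw [if_neg (fun hm => ha ((natAdd_mem_support_partitionExpo u w a).mp hm)), if_neg ha, mul_zero]

/-! ## 2. The partition matrix of the intersection witness is `2^{#(u ∩ w)}` -/

/-- Partial products over a set `S` of coordinates:
`coeff_{E u w} ∏_{a ∈ S} (1 + x_a − y_a)(1 + 2 y_a) = [u ⊆ S ∧ w ⊆ S] · 2^{#(u ∩ w)}`. -/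
theorem coeff_partitionExpo_intersectionWitness_subset {R : Type*} [CommRing R] (S : Finset (Fin h))
    (u w : Finset (Fin h)) :
    coeff (∑ b ∈ u, Finsupp.single (Fin.castAdd h b) 1 + ∑ c ∈ w, Finsupp.single (Fin.natAdd h c) 1)
        (∏ a ∈ S, ((1 + X (Fin.castAdd h a) - X (Fin.natAdd h a)) * (1 + 2 * X (Fin.natAdd h a)) :
          MvPolynomial (Fin (h + h)) R)) =
      if u ⊆ S ∧ w ⊆ S then (2 : R) ^ (u ∩ w).card else 0 := by
  classical
  induction S using Finset.induction_on generalizing u w with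
  | empty =>
    rw [Finset.prod_empty, coeff_partitionExpo_one]
    by_cases huw : u = ∅ ∧ w = ∅
    · obtain ⟨rfl, rfl⟩ := huw
      simp
    · rw [if_neg huw, if_neg]
      rintro ⟨hu, hw⟩
      exact huw ⟨Finset.subset_empty.mp hu, Finset.subset_empty.mp hw⟩
  | insert a S haS ih =>
    rw [Finset.prod_insert haS, mul_comm, ← mul_assoc, coeff_partitionExpo_mul_one_add_two_Y,
      coeff_partitionExpo_mul_one_add_X_sub_Y, coeff_partitionExpo_mul_one_add_X_sub_Y]
    simp only [ih]
    have heu : a ∉ u.erase a := Finset.notMem_erase a u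
    have hew : a ∉ w.erase a := Finset.notMem_erase a w
    -- vanishing facts (`a ∉ S`)
    have vu : a ∈ u → ∀ v : Finset (Fin h), ¬ (u ⊆ S ∧ v ⊆ S) := fun hau v hh => haS (hh.1 hau)
    have vw : a ∈ w → ∀ v : Finset (Fin h), ¬ (v ⊆ S ∧ w ⊆ S) := fun haw v hh => haS (hh.2 haw)
    have sub_iff : ∀ v : Finset (Fin h), a ∈ v → (v ⊆ insert a S ↔ v.erase a ⊆ S) := fun v hav => by
      constructor
      · intro hs b hb
        exact (Finset.mem_insert.mp (hs (Finset.mem_erase.mp hb).2)).resolve_left (Finset.mem_erase.mp hb).1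
      · intro hs b hb
        by_cases hba : b = a
        · rw [hba]; exact Finset.mem_insert_self _ _
        · exact Finset.mem_insert_of_mem (hs (Finset.mem_erase.mpr ⟨hba, hb⟩))
    have sub_iff_n : ∀ v : Finset (Fin h), a ∉ v → (v ⊆ insert a S ↔ v ⊆ S) := fun v hav => by
      constructor
      · intro hs b hb
        exact (Finset.mem_insert.mp (hs hb)).resolve_left (fun e => hav (e ▸ hb))
      · intro hs; exact hs.trans (Finset.subset_insert _ _)
    have sub_iff_u := sub_iff u
    have sub_iff_w := sub_iff w
    have sub_iff_nu := sub_iff_n u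
    have sub_iff_nw := sub_iff_n w
    by_cases hau : a ∈ u
    · by_cases haw : a ∈ w
      · -- `a ∈ u`, `a ∈ w`: only the doubly-deleted term survives, with the factor `2`
        simp only [hau, haw, ↓reduceIte, Finset.mem_erase, ne_eq, not_true_eq_false, false_and,
          if_neg (vu hau w), if_neg (vu hau (w.erase a)), if_neg (vw haw (u.erase a)),
          zero_add, add_zero, sub_zero]
        have hcard : (u ∩ w).card = (u.erase a ∩ w.erase a).card + 1 := by
          have hset : u.erase a ∩ w.erase a = (u ∩ w).erase a := by
            ext x
            simp only [Finset.mem_inter, Finset.mem_erase]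
            tauto
          rw [hset, Finset.card_erase_of_mem (Finset.mem_inter.mpr ⟨hau, haw⟩)]
          have : 0 < (u ∩ w).card := Finset.card_pos.mpr ⟨a, Finset.mem_inter.mpr ⟨hau, haw⟩⟩
          omega
        by_cases hg : u ⊆ insert a S ∧ w ⊆ insert a S
        · rw [if_pos hg, if_pos ⟨(sub_iff_u hau).mp hg.1, (sub_iff_w haw).mp hg.2⟩, hcard, pow_succ]
          ring
        · rw [if_neg hg, if_neg (fun hh => hg ⟨(sub_iff_u hau).mpr hh.1, (sub_iff_w haw).mpr hh.2⟩)]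
          ring
      · -- `a ∈ u`, `a ∉ w`
        simp only [hau, haw, ↓reduceIte, if_neg (vu hau w), zero_add, add_zero, sub_zero]
        have hcard : (u ∩ w).card = (u.erase a ∩ w).card := by
          rw [Finset.erase_inter, Finset.erase_eq_of_notMem]
          exact fun hm => haw (Finset.mem_inter.mp hm).2
        by_cases hg : u ⊆ insert a S ∧ w ⊆ insert a S
        · rw [if_pos hg, if_pos ⟨(sub_iff_u hau).mp hg.1, (sub_iff_nw haw).mp hg.2⟩, hcard]
        · rw [if_neg hg, if_neg (fun hh => hg ⟨(sub_iff_u hau).mpr hh.1, (sub_iff_nw haw).mpr hh.2⟩)]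
    · by_cases haw : a ∈ w
      · -- `a ∉ u`, `a ∈ w`
        simp only [hau, haw, ↓reduceIte, if_neg (vw haw u), add_zero, zero_sub, hew,
          sub_zero]
        have hcard : (u ∩ w).card = (u ∩ w.erase a).card := by
          rw [Finset.inter_erase, Finset.erase_eq_of_notMem]
          exact fun hm => hau (Finset.mem_inter.mp hm).1
        by_cases hg : u ⊆ insert a S ∧ w ⊆ insert a S
        · rw [if_pos hg, if_pos ⟨(sub_iff_nu hau).mp hg.1, (sub_iff_w haw).mp hg.2⟩, hcard]
          ring
        · rw [if_neg hg, if_neg (fun hh => hg ⟨(sub_iff_nu hau).mpr hh.1, (sub_iff_w haw).mpr hh.2⟩)]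
          ring
      · -- `a ∉ u`, `a ∉ w`
        simp only [hau, haw, ↓reduceIte, add_zero, sub_zero]
        by_cases hg : u ⊆ insert a S ∧ w ⊆ insert a S
        · rw [if_pos hg, if_pos ⟨(sub_iff_nu hau).mp hg.1, (sub_iff_nw haw).mp hg.2⟩]
        · rw [if_neg hg, if_neg (fun hh => hg ⟨(sub_iff_nu hau).mpr hh.1, (sub_iff_nw haw).mpr hh.2⟩)]

/-- **The partition matrix of the intersection witness**:
`coeff_{x^u y^w} ∏_a (1 + x_a − y_a)(1 + 2 y_a) = 2^{#(u ∩ w)}`. -/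
theorem coeff_partitionExpo_intersectionWitness {R : Type*} [CommRing R] (u w : Finset (Fin h)) :
    coeff (∑ b ∈ u, Finsupp.single (Fin.castAdd h b) 1 + ∑ c ∈ w, Finsupp.single (Fin.natAdd h c) 1)
        (∏ a : Fin h, ((1 + X (Fin.castAdd h a) - X (Fin.natAdd h a)) * (1 + 2 * X (Fin.natAdd h a)) :
          MvPolynomial (Fin (h + h)) R)) =
      (2 : R) ^ (u ∩ w).card := by
  rw [coeff_partitionExpo_intersectionWitness_subset, if_pos ⟨Finset.subset_univ _, Finset.subset_univ _⟩]

/-! ## 3. The hit class `det[2^{#(u i ∩ w j)}] ≠ 0` -/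

/-- The `h + h` intersection forms, `1 + x_a − y_a` then `1 + 2 y_a`, indexed by `Fin (h + h)`. -/
theorem prod_intersectionForms_eq :
    (∏ k : Fin (h + h), Fin.addCases (motive := fun _ => MvPolynomial (Fin (h + h)) ℂ)
        (fun a => 1 + X (Fin.castAdd h a) - X (Fin.natAdd h a)) (fun a => 1 + 2 * X (Fin.natAdd h a)) k) =
      ∏ a : Fin h, ((1 + X (Fin.castAdd h a) - X (Fin.natAdd h a)) * (1 + 2 * X (Fin.natAdd h a)) :
        MvPolynomial (Fin (h + h)) ℂ) := by
  rw [Fin.prod_univ_add, ← Finset.prod_mul_distrib]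
  refine Finset.prod_congr rfl fun a _ => ?_
  rw [Fin.addCases_left, Fin.addCases_right]

/-- The intersection forms are affine. -/
theorem totalDegree_intersectionForms_le (k : Fin (h + h)) :
    (Fin.addCases (motive := fun _ => MvPolynomial (Fin (h + h)) ℂ)
        (fun a => 1 + X (Fin.castAdd h a) - X (Fin.natAdd h a)) (fun a => 1 + 2 * X (Fin.natAdd h a)) k
      ).totalDegree ≤ 1 := by
  refine Fin.addCases (fun a => ?_) (fun a => ?_) k
  · rw [Fin.addCases_left]
    refine (totalDegree_sub _ _).trans (max_le ?_ (isHomogeneous_X ℂ _).totalDegree_le)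
    refine (totalDegree_add _ _).trans (max_le ?_ (isHomogeneous_X ℂ _).totalDegree_le)
    rw [totalDegree_one]; exact Nat.zero_le _
  · rw [Fin.addCases_right]
    refine (totalDegree_add _ _).trans (max_le ?_ ?_)
    · rw [totalDegree_one]; exact Nat.zero_le _
    · refine (totalDegree_mul _ _).trans ?_
      rw [show (2 : MvPolynomial (Fin (h + h)) ℂ) = C 2 from (map_ofNat C 2).symm, totalDegree_C,
        totalDegree_X]

/-- **Every layout with nonsingular minor `det[2^{#(u i ∩ w j)}]` is Chow-hit**, at every height and
every size, by the one explicit product `∏_a (1 + x_a − y_a)(1 + 2 y_a)`. -/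
theorem chow_hit_of_interPowMinor {r : ℕ} (u w : Fin r → Finset (Fin h))
    (hdet : (Matrix.of fun i j : Fin r => (2 : ℂ) ^ (u i ∩ w j).card).det ≠ 0) :
    ∃ ℓ : Fin (h + h) → MvPolynomial (Fin (h + h)) ℂ, (∀ q, (ℓ q).totalDegree ≤ 1) ∧
      (Matrix.of fun i j : Fin r => coeff
        (∑ b ∈ u i, Finsupp.single (Fin.castAdd h b) 1 + ∑ d ∈ w j, Finsupp.single (Fin.natAdd h d) 1)
        (∏ q, ℓ q)).det ≠ 0 := by
  refine ⟨fun k => Fin.addCases (motive := fun _ => MvPolynomial (Fin (h + h)) ℂ)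
      (fun a => 1 + X (Fin.castAdd h a) - X (Fin.natAdd h a)) (fun a => 1 + 2 * X (Fin.natAdd h a)) k,
    totalDegree_intersectionForms_le, ?_⟩
  have hM : (Matrix.of fun i j : Fin r => coeff
      (∑ b ∈ u i, Finsupp.single (Fin.castAdd h b) 1 + ∑ d ∈ w j, Finsupp.single (Fin.natAdd h d) 1)
      (∏ q : Fin (h + h), Fin.addCases (motive := fun _ => MvPolynomial (Fin (h + h)) ℂ)
        (fun a => 1 + X (Fin.castAdd h a) - X (Fin.natAdd h a)) (fun a => 1 + 2 * X (Fin.natAdd h a)) q)) =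
      Matrix.of fun i j : Fin r => (2 : ℂ) ^ (u i ∩ w j).card := by
    ext i j
    rw [Matrix.of_apply, Matrix.of_apply, prod_intersectionForms_eq,
      coeff_partitionExpo_intersectionWitness]
  rw [hM]
  exact hdet

/-! ## 4. Star rows with arbitrary centre against affinely independent columns -/

/-- **The intersection-power minor of a star against any columns factors through the affine
matrix.**  Rows `u 0 = B`, `u (a+1) = B ∆ {a}` (`B.erase a` if `a ∈ B`, `insert a B` otherwise);
then `det[2^{#(u i ∩ w j)}] = (∏_j 2^{#(B ∩ w j)}) · (∏_a κ_a) · det[1 ; [a ∈ w j]]` with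
`κ_a = -1/2` for `a ∈ B` and `κ_a = 1` for `a ∉ B`. -/
theorem det_interPow_star (B : Finset (Fin h)) (u w : Fin (h + 1) → Finset (Fin h))
    (hu0 : u 0 = B) (hu : ∀ a : Fin h, (a ∈ B → u a.succ = B.erase a) ∧ (a ∉ B → u a.succ = insert a B)) :
    (Matrix.of fun i j : Fin (h + 1) => (2 : ℂ) ^ (u i ∩ w j).card).det =
      (∏ j : Fin (h + 1), (2 : ℂ) ^ (B ∩ w j).card) *
        ((∏ a : Fin h, (if a ∈ B then (-1 / 2 : ℂ) else 1)) *
          (Matrix.of fun i j : Fin (h + 1) =>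
            Fin.cases (motive := fun _ => ℂ) 1 (fun a => if a ∈ w j then 1 else 0) i).det) := by
  classical
  -- the lower-triangular transition matrix
  set T : Matrix (Fin (h + 1)) (Fin (h + 1)) ℂ := Matrix.of fun i k =>
    Fin.cases (motive := fun _ => ℂ) (Fin.cases (motive := fun _ => ℂ) 1 (fun _ => 0) k)
      (fun a => Fin.cases (motive := fun _ => ℂ) 1
        (fun a' => if a = a' then (if a ∈ B then (-1 / 2 : ℂ) else 1) else 0) k) i with hT
  set Aff : Matrix (Fin (h + 1)) (Fin (h + 1)) ℂ := Matrix.of fun i j : Fin (h + 1) =>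
    Fin.cases (motive := fun _ => ℂ) 1 (fun a => if a ∈ w j then 1 else 0) i with hAff
  -- entries: `2^{#(u i ∩ w j)} = 2^{#(B ∩ w j)} · (T * Aff) i j`
  have hentry : ∀ i j : Fin (h + 1),
      (2 : ℂ) ^ (u i ∩ w j).card = (2 : ℂ) ^ (B ∩ w j).card * (T * Aff) i j := by
    intro i j
    rw [Matrix.mul_apply, Fin.sum_univ_succ]
    refine Fin.cases ?_ (fun a => ?_) i
    · -- the centre row
      simp [hT, hAff, hu0]
    · -- the row `B ∆ {a}`
      have hsum : ∑ k : Fin h, T a.succ k.succ * Aff k.succ j =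
          (if a ∈ B then (-1 / 2 : ℂ) else 1) * (if a ∈ w j then 1 else 0) := by
        rw [Finset.sum_eq_single a]
        · simp [hT, hAff]
        · intro a' _ ha'
          simp [hT, Ne.symm ha']
        · intro ha; exact absurd (Finset.mem_univ a) ha
      rw [hsum]
      simp only [hT, hAff, Matrix.of_apply, Fin.cases_succ, Fin.cases_zero, mul_one]
      by_cases haB : a ∈ B
      · rw [(hu a).1 haB, if_pos haB]
        by_cases haw : a ∈ w j
        · rw [if_pos haw, Finset.erase_inter, Finset.card_erase_of_mem (Finset.mem_inter.mpr ⟨haB, haw⟩)]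
          have hpos : 0 < (B ∩ w j).card := Finset.card_pos.mpr ⟨a, Finset.mem_inter.mpr ⟨haB, haw⟩⟩
          obtain ⟨m, hm⟩ : ∃ m, (B ∩ w j).card = m + 1 := ⟨_, (Nat.succ_pred_eq_of_pos hpos).symm⟩
          rw [hm, Nat.add_sub_cancel, pow_succ]
          ring
        · rw [if_neg haw, Finset.erase_inter, Finset.erase_eq_of_notMem (fun hm =>
            haw (Finset.mem_inter.mp hm).2)]
          ring
      · rw [(hu a).2 haB, if_neg haB]
        by_cases haw : a ∈ w j
        · rw [if_pos haw, Finset.insert_inter_of_mem haw, Finset.card_insert_of_notMem (fun hm =>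
            haB (Finset.mem_inter.mp hm).1), pow_succ]
          ring
        · rw [if_neg haw, Finset.insert_inter_of_notMem haw]
          ring
  have hM : (Matrix.of fun i j : Fin (h + 1) => (2 : ℂ) ^ (u i ∩ w j).card) =
      Matrix.of fun i j : Fin (h + 1) => (2 : ℂ) ^ (B ∩ w j).card * (T * Aff) i j := by
    ext i j
    rw [Matrix.of_apply, Matrix.of_apply, hentry]
  -- `T` is lower triangular with diagonal `1, κ_0, …, κ_{h-1}`
  have hTtri : T.BlockTriangular OrderDual.toDual := by
    intro i k hik
    have hik' : i < k := hik
    revert hik'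
    refine Fin.cases ?_ (fun a => ?_) i <;> refine Fin.cases ?_ (fun a' => ?_) k
    · intro hh; exact absurd hh (lt_irrefl _)
    · intro _; simp [hT]
    · intro hh; exact absurd (Fin.succ_pos a) (not_lt.mpr hh.le)
    · intro hh
      have hne : a ≠ a' := fun e => by rw [e] at hh; exact lt_irrefl _ hh
      simp [hT, hne]
  have hTdet : T.det = ∏ a : Fin h, (if a ∈ B then (-1 / 2 : ℂ) else 1) := by
    rw [Matrix.det_of_lowerTriangular T hTtri, Fin.prod_univ_succ]
    simp [hT]
  rw [hM, Matrix.det_mul_row, Matrix.det_mul, hTdet]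

/-- **STAR ROWS WITH ARBITRARY CENTRE × AFFINELY INDEPENDENT COLUMNS are Chow-hit, every height**
(item 20172's conclusion on this class).  Rows: the Hamming ball of radius `1` around `B ⊆ Fin h`
(`u 0 = B`, `u (a+1) = B ∆ {a}`); columns: any `h + 1` sets `w j` whose affine matrix
`[1 ; [a ∈ w j]]` is nonsingular.  Witness: `∏_a (1 + x_a − y_a)(1 + 2 y_a)`. -/
theorem chow_hit_star_of_affineIndependent (B : Finset (Fin h)) (u w : Fin (h + 1) → Finset (Fin h))
    (hu0 : u 0 = B) (hu : ∀ a : Fin h, (a ∈ B → u a.succ = B.erase a) ∧ (a ∉ B → u a.succ = insert a B))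
    (hw : (Matrix.of fun i j : Fin (h + 1) =>
      Fin.cases (motive := fun _ => ℂ) 1 (fun a => if a ∈ w j then 1 else 0) i).det ≠ 0) :
    ∃ ℓ : Fin (h + h) → MvPolynomial (Fin (h + h)) ℂ, (∀ q, (ℓ q).totalDegree ≤ 1) ∧
      (Matrix.of fun i j : Fin (h + 1) => coeff
        (∑ b ∈ u i, Finsupp.single (Fin.castAdd h b) 1 + ∑ d ∈ w j, Finsupp.single (Fin.natAdd h d) 1)
        (∏ q, ℓ q)).det ≠ 0 := by
  refine chow_hit_of_interPowMinor u w ?_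
  rw [det_interPow_star B u w hu0 hu]
  refine mul_ne_zero (Finset.prod_ne_zero_iff.mpr fun j _ => pow_ne_zero _ two_ne_zero)
    (mul_ne_zero (Finset.prod_ne_zero_iff.mpr fun a _ => ?_) hw)
  split_ifs <;> norm_num

/-! ## 5. The full `2^h × 2^h` layout -/

/-- **The FULL layout is Chow-hit, every height**: if the rows `u` and the columns `w` both run through
ALL subsets of `Fin h` (bijectively, in any orders), the partition matrix `[2^{#(u i ∩ w j)}]` of the
intersection witness is `Z · Z'ᵀ` for two permuted inclusion matrices and has determinant `≠ 0`. -/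
theorem chow_hit_powerset {r : ℕ} (u w : Fin r → Finset (Fin h)) (hu : Function.Bijective u)
    (hw : Function.Bijective w) :
    ∃ ℓ : Fin (h + h) → MvPolynomial (Fin (h + h)) ℂ, (∀ q, (ℓ q).totalDegree ≤ 1) ∧
      (Matrix.of fun i j : Fin r => coeff
        (∑ b ∈ u i, Finsupp.single (Fin.castAdd h b) 1 + ∑ d ∈ w j, Finsupp.single (Fin.natAdd h d) 1)
        (∏ q, ℓ q)).det ≠ 0 := by
  classical
  refine chow_hit_of_interPowMinor u w ?_
  -- `2^{#(u i ∩ w j)} = Σ_k [u k ⊆ u i] [u k ⊆ w j]`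
  set A : Matrix (Fin r) (Fin r) ℂ := Matrix.of fun i k => if u k ⊆ u i then (1 : ℂ) else 0 with hA
  set Bm : Matrix (Fin r) (Fin r) ℂ := Matrix.of fun k j => if u k ⊆ w j then (1 : ℂ) else 0 with hBm
  have hM : (Matrix.of fun i j : Fin r => (2 : ℂ) ^ (u i ∩ w j).card) = A * Bm := by
    ext i j
    rw [Matrix.mul_apply, Matrix.of_apply]
    have hsum : ∑ k, A i k * Bm k j = ∑ k, (if u k ⊆ u i ∩ w j then (1 : ℂ) else 0) := by
      refine Finset.sum_congr rfl fun k _ => ?_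
      simp only [hA, hBm, Matrix.of_apply, Finset.subset_inter_iff]
      by_cases h1 : u k ⊆ u i <;> by_cases h2 : u k ⊆ w j <;> simp [h1, h2]
    rw [hsum, Finset.sum_boole]
    -- the number of `k` with `u k ⊆ u i ∩ w j` is the number of subsets of `u i ∩ w j`
    have hcard : (Finset.univ.filter fun k => u k ⊆ u i ∩ w j).card = (u i ∩ w j).powerset.card := by
      refine Finset.card_bij (fun k _ => u k) (fun k hk => ?_) (fun k₁ _ k₂ _ e => hu.1 e) (fun S hS => ?_)
      · exact Finset.mem_powerset.mpr (Finset.mem_filter.mp hk).2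
      · obtain ⟨k, hk⟩ := hu.2 S
        exact ⟨k, Finset.mem_filter.mpr ⟨Finset.mem_univ _, hk ▸ Finset.mem_powerset.mp hS⟩, hk⟩
    rw [hcard, Finset.card_powerset]
    push_cast
    rfl
  rw [hM, Matrix.det_mul]
  -- `A` is the transpose of the inclusion matrix of `u`; `Bm` is a row-permuted inclusion matrix
  have hAdet : A.det = 1 := by
    have e : A = (Matrix.of fun i k : Fin r => if u i ⊆ u k then (1 : ℂ) else 0).transpose := by
      ext i k; simp [hA, Matrix.transpose_apply]
    rw [e, Matrix.det_transpose, det_inclusionMatrix u hu.1]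
  set σ : Equiv.Perm (Fin r) := (Equiv.ofBijective w hw).trans (Equiv.ofBijective u hu).symm with hσdef
  have hσ : ∀ j, w j = u (σ j) := fun j => (Equiv.ofBijective_apply_symm_apply u hu (w j)).symm
  have hBdet : Bm.det ≠ 0 := by
    have e : Bm = (Matrix.of fun k j : Fin r => if u k ⊆ u j then (1 : ℂ) else 0).submatrix id σ := by
      ext k j; simp [hBm, Matrix.submatrix_apply, hσ j]
    rw [e, Matrix.det_permute', det_inclusionMatrix u hu.1, mul_one]
    rcases Int.units_eq_one_or (Equiv.Perm.sign σ) with hs | hs <;> simp [hs]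
  exact mul_ne_zero (by rw [hAdet]; exact one_ne_zero) hBdet

end

end Summit.ValiantsHypothesis.ValiantsHypothesis.Theorems.BarrierLever.ChowFactor
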